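import Summits.BirchSwinnertonDyer.BirchSwinnertonDyer.Theorems.UniversalToricDescentResidualCorankOneCriterion
import Mathlib.RingTheory.UniqueFactorizationDomain.Multiplicity
import Mathlib.LinearAlgebra.LinearIndependent.Lemmas
import Mathlib.LinearAlgebra.Dimension.Finite
import HarnessLib

/-!
# Route UniversalToricDescent — RESIDUAL RANK `≤ 1`: `finrank_Λ X ≤ 1 ∧ μ(X_tors) = 0` ⟹ `X/pX` is pairwise `Ω`-dependent
# ⟹ `#((X/pX) ⧸ T^m) ≤ p^{m + C}` for ALL `m` (any prime `p`; support algebra for the port stub K2∣β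
# `stub_residualCorankLeOneMultOfBeta` of line `beta-road` v7 on crux `TwinAlgMuZeroAtThree`, stmt-BirchSwinnertonDyer-24737)

Width prover `bsd-wall-utd-p1-w2` g11 under lead `bsd-wall-utd-p1` g23 (`--supports stmt-BirchSwinnertonDyer-24737`, helper; bricks E7/E8
of the lead's `STUB-BRIEF-K2beta-v7`). THEOREMS ONLY (no definition, no named fact, no `sorry`); no `Theses` import. BSD is not proved
by any of this; 24737 stays OPEN. Companion of the lead's p746766 `…ResidualGrowthOfRankOne.residual_growth_of_rank_one` (rank one,
`t/pt` finite ⟹ growth at `m = pⁿ`, via the rank-one reflexive hull): here a second, hull-free route through RESIDUAL RELATIONS, which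
also covers `finrank ≤ 1` (rank zero included) and every exponent `m`; the Selmer side is `…ResidualGrowthSelmerSide`.

* §1 (over `Ω = k⟦T⟧`, `k` finite) `exists_natCard_quotient_X_pow_le_of_pairwise_dependent`: a finitely generated `Ω`-module `V` in
  which ANY TWO elements are linearly dependent has `#(V ⧸ T^m V) ≤ (#k)^{m + C}` for all `m` (structure-theorem-free: `V` torsion ⟹
  finite; else `ψ : V ↠ Ω` has torsion, hence finite, kernel `K` and `#(V/T^m V) = #((K + T^m V)/T^m V) · #(Ω/T^m) ≤ #K · (#k)^m`).
* §2 (over `Λ = ℤ_p⟦T⟧`) `exists_not_mem_augIdealP_forall_smul_eq_zero` (`μ(M) = 0`, `M` torsion ⟹ some `g ∉ pΛ` kills `M`: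
  `μ` is the local length at `(p)`); `exists_residual_relation`: `finrank_Λ X ≤ 1 ∧ μ(X_tors) = 0` ⟹ any two `u, v ∈ X` satisfy
  `a·u + b·v = 0` with `a ∉ pΛ` or `b ∉ pΛ` (a rank relation, divided by `p` while both coefficients lie in `pΛ` — finitely often,
  `p` having finite multiplicity in a non-zero power series — inside the `p`-saturated `X_tors`, then multiplied by the annihilator
  `g`); `exists_natCard_residualQuotient_le_of_residual_relation` / `…_of_finrank_le_one`: hence **`#((X/pX) ⧸ T^m) ≤ p^{m + C}`**
  for all `m` (`X/pX` as an `Ω`-module through `Λ/p ≅ 𝔽_p⟦T⟧`, §1).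

References: [Washington1997] §13.2; [GreenbergLNM1716] §1 p. 60; the module-theoretic statements are folklore.
-/

set_option linter.dupNamespace false
set_option autoImplicit false

noncomputable section

open scoped Classical

namespace Summit.BirchSwinnertonDyer.BirchSwinnertonDyer.Theorems.UniversalToricDescentResidualRankLeOneGrowth

/-! ## §1 Over `Ω = k⟦T⟧`: pairwise dependent ⟹ growth `≤ (#k)^{m + C}` -/

section Omega

open PowerSeries
open Summit.BirchSwinnertonDyer.BirchSwinnertonDyer.Theorems.UniversalToricDescentResidualLayerAlgebra

universe u v

variable {k : Type u} [Field k] {V : Type v} [AddCommGroup V] [Module k⟦X⟧ V]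

/-- **Pairwise dependent ⟹ residual growth of rank at most one.** Let `V` be a finitely generated module over `Ω = k⟦T⟧`
(`k` a finite field) in which any two elements satisfy a non-trivial linear relation. Then there is `C` with
`#(V ⧸ T^m V) ≤ (#k)^{m + C}` for every `m`. (If `V` is torsion it is finite; otherwise a surjection `ψ : V ↠ Ω` has torsion,
hence finite, kernel `K`, `V/(K + T^m V) ≅ Ω/T^m`, and `(K + T^m V)/T^m V` is a quotient of `K`.)
[cite: Washington1997, §13.2] -/
theorem exists_natCard_quotient_X_pow_le_of_pairwise_dependent [Finite k] [Module.Finite k⟦X⟧ V]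
    (hdep : ∀ u v : V, ∃ a b : k⟦X⟧, (a ≠ 0 ∨ b ≠ 0) ∧ a • u + b • v = 0) :
    ∃ C : ℕ, ∀ m : ℕ,
      Nat.card (V ⧸ (Ideal.span {(X : k⟦X⟧) ^ m} • (⊤ : Submodule k⟦X⟧ V))) ≤ Nat.card k ^ (m + C) := by
  haveI : IsNoetherian k⟦X⟧ V := isNoetherian_of_isNoetherianRing_of_finite _ _
  have hk : 1 < Nat.card k := Finite.one_lt_card
  by_cases hV : Module.IsTorsion k⟦X⟧ V
  · -- `V` is finite
    haveI : Finite V := finite_of_isTorsion hV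
    refine ⟨Nat.card V, fun m => ?_⟩
    calc Nat.card (V ⧸ (Ideal.span {(X : k⟦X⟧) ^ m} • (⊤ : Submodule k⟦X⟧ V)))
          ≤ Nat.card V := Nat.card_le_card_of_surjective _ (Submodule.mkQ_surjective _)
      _ ≤ Nat.card k ^ Nat.card V := (Nat.lt_pow_self hk).le
      _ ≤ Nat.card k ^ (m + Nat.card V) := Nat.pow_le_pow_right hk.le (Nat.le_add_left _ _)
  · -- a surjection onto `Ω` with torsion kernel
    obtain ⟨ψ, hψ⟩ := exists_surjective_of_not_isTorsion hV
    obtain ⟨v₀, hv₀⟩ := hψ 1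
    let K : Submodule k⟦X⟧ V := LinearMap.ker ψ
    have hK : Module.IsTorsion k⟦X⟧ K := by
      intro w
      obtain ⟨a, b, hab, h⟩ := hdep (w : V) v₀
      have hb : b = 0 := by
        have h' := congrArg ψ h
        rw [map_add, map_smul, map_smul, map_zero, LinearMap.mem_ker.mp w.2, smul_zero, zero_add, hv₀,
          smul_eq_mul, mul_one] at h'
        exact h'
      have ha : a ≠ 0 := by
        rcases hab with ha | hb'
        · exact ha
        · exact absurd hb hb'
      rw [hb, zero_smul, add_zero] at h
      refine ⟨⟨a, mem_nonZeroDivisors_of_ne_zero ha⟩, ?_⟩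
      rw [Submonoid.mk_smul]
      exact Subtype.ext (by rw [Submodule.coe_smul, Submodule.coe_zero]; exact h)
    haveI : Module.Finite k⟦X⟧ K := Module.Finite.iff_fg.mpr (IsNoetherian.noetherian K)
    haveI : Finite K := finite_of_isTorsion hK
    refine ⟨Nat.card K, fun m => ?_⟩
    let I : Ideal k⟦X⟧ := Ideal.span {(X : k⟦X⟧) ^ m}
    let S : Submodule k⟦X⟧ V := I • ⊤
    -- Lagrange: `#(V/S) = #((K ⊔ S)/S) · #(V/(K ⊔ S))`
    have hlag := Submodule.card_quotient_mul_card_quotient (K ⊔ S) S le_sup_right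
    -- `(K ⊔ S)/S` is a quotient of `K`
    have hB : Nat.card ((K ⊔ S).map S.mkQ) ≤ Nat.card K := by
      refine Nat.card_le_card_of_surjective
        (fun w : K => ⟨S.mkQ (w : V), Submodule.mem_map_of_mem (Submodule.mem_sup_left w.2)⟩) ?_
      rintro ⟨y, hy⟩
      obtain ⟨x, hx, rfl⟩ := Submodule.mem_map.mp hy
      obtain ⟨w, hw, s, hs, rfl⟩ := Submodule.mem_sup.mp hx
      refine ⟨⟨w, hw⟩, Subtype.ext ?_⟩
      change S.mkQ w = S.mkQ (w + s)
      rw [map_add, Submodule.mkQ_apply, Submodule.mkQ_apply, (Submodule.Quotient.mk_eq_zero S).mpr hs,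
        add_zero]
    -- `V/(K ⊔ S) ≅ Ω/(T^m)` through `ψ`
    have hle₁ : (K ⊔ S) ≤ Submodule.comap ψ (I.restrictScalars k⟦X⟧) := by
      rw [sup_le_iff]
      constructor
      · intro v hv
        rw [Submodule.mem_comap, Submodule.restrictScalars_mem, LinearMap.mem_ker.mp hv]
        exact Submodule.zero_mem _
      · rw [show S = I • ⊤ from rfl, ← Submodule.map_le_iff_le_comap, Submodule.map_smul'']
        refine (Submodule.smul_mono le_rfl le_top).trans ?_
        intro f hf
        rw [Submodule.restrictScalars_mem]
        have : I • (⊤ : Submodule k⟦X⟧ k⟦X⟧) = I := by rw [Ideal.smul_eq_mul, Ideal.mul_top]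
        rw [← this]; exact hf
    let θ := Submodule.mapQ (K ⊔ S) (I.restrictScalars k⟦X⟧) ψ hle₁
    have hθs : Function.Surjective θ := by
      intro y
      induction y using Submodule.Quotient.induction_on with
      | H f =>
        obtain ⟨x, rfl⟩ := hψ f
        exact ⟨Submodule.Quotient.mk x, by rw [Submodule.mapQ_apply]⟩
    have hθi : Function.Injective θ := by
      rw [← LinearMap.ker_eq_bot, LinearMap.ker_eq_bot']
      intro q hq
      induction q using Submodule.Quotient.induction_on with
      | H x =>
        rw [Submodule.mapQ_apply, Submodule.Quotient.mk_eq_zero, Submodule.restrictScalars_mem,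
          Ideal.mem_span_singleton] at hq
        obtain ⟨f, hf⟩ := hq
        obtain ⟨w, rfl⟩ := hψ f
        rw [Submodule.Quotient.mk_eq_zero]
        have h1 : x - ((X : k⟦X⟧) ^ m) • w ∈ K := by
          rw [LinearMap.mem_ker, map_sub, map_smul, hf, smul_eq_mul, sub_self]
        have h2 : ((X : k⟦X⟧) ^ m) • w ∈ S :=
          Submodule.smul_mem_smul (Ideal.mem_span_singleton_self _) Submodule.mem_top
        have := Submodule.add_mem_sup h1 h2
        rwa [sub_add_cancel] at this
    have hcardQ : Nat.card (V ⧸ (K ⊔ S)) = Nat.card k ^ m := by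
      calc Nat.card (V ⧸ (K ⊔ S)) = Nat.card (k⟦X⟧ ⧸ I.restrictScalars k⟦X⟧) :=
            Nat.card_congr (Equiv.ofBijective θ ⟨hθi, hθs⟩)
        _ = Nat.card (k⟦X⟧ ⧸ I) := by rw [Submodule.restrictScalars_self]
        _ = Nat.card k ^ m := natCard_quotient_X_pow m
    calc Nat.card (V ⧸ S) = Nat.card ((K ⊔ S).map S.mkQ) * Nat.card (V ⧸ (K ⊔ S)) := hlag.symm
      _ ≤ Nat.card K * Nat.card k ^ m := Nat.mul_le_mul hB hcardQ.le
      _ ≤ Nat.card k ^ Nat.card K * Nat.card k ^ m := Nat.mul_le_mul_right _ (Nat.lt_pow_self hk).le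
      _ = Nat.card k ^ (m + Nat.card K) := by rw [← pow_add, add_comm]

end Omega

/-! ## §2 Over `Λ = ℤ_p⟦T⟧`: `finrank ≤ 1 ∧ μ(X_tors) = 0` ⟹ residual relations ⟹ residual growth -/

section Lambda

open Literature.NumberTheory.EllipticCurves Literature.NumberTheory.EllipticCurves.IwasawaAlgebra
  Literature.NumberTheory.EllipticCurves.IwasawaModuleFinitePadicInt
  Summit.BirchSwinnertonDyer.BirchSwinnertonDyer.Theorems.UniversalToricDescentResidualLayerAlgebra
  Summit.BirchSwinnertonDyer.BirchSwinnertonDyer.Theorems.UniversalToricDescentResidualCorankOne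

variable {p : ℕ} [Fact p.Prime]
variable {M : Type*} [AddCommGroup M] [Module (IwasawaAlgebra p) M]

/-- **`μ = 0` ⟹ an annihilator outside `pΛ`.** A finitely generated torsion `Λ`-module `M` with `μ(M) = 0` is killed by some
`g ∉ pΛ`: `μ(M)` is the local length of `M` at the height-one prime `(p)`, so `μ(M) = 0` says `M_{(p)} = 0`, i.e.
`Ann(M) ⊄ (p)`. [cite: Washington1997, §13.2] -/
theorem exists_not_mem_augIdealP_forall_smul_eq_zero [Module.Finite (IwasawaAlgebra p) M]
    (hM : Module.IsTorsion (IwasawaAlgebra p) M) (hμ : muInvariant p M = 0) :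
    ∃ g : IwasawaAlgebra p, g ∉ augIdealP p ∧ ∀ x : M, g • x = 0 := by
  classical
  let 𝔭 : PrimeSpectrum (IwasawaAlgebra p) := ⟨augIdealP p, isPrime_augIdealP_holds p⟩
  have h0 : Module.lengthAt (IwasawaAlgebra p) M 𝔭 = 0 := by
    have h1 := muInvariant_eq_toNat_lengthAt p M 𝔭 rfl
    rw [hμ] at h1
    exact (ENat.toNat_eq_zero.mp h1.symm).resolve_right (lengthAt_ne_top_of_isTorsion p M hM 𝔭 rfl)
  rw [Module.lengthAt, Module.length_eq_zero_iff, ← Module.notMem_support_iff,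
    Module.mem_support_iff_of_finite, SetLike.not_le_iff_exists] at h0
  obtain ⟨g, hg, hgp⟩ := h0
  rw [Module.mem_annihilator] at hg
  exact ⟨g, hgp, hg⟩

/-- A non-zero element of `Λ = ℤ_p⟦T⟧` is divisible by only finitely many powers of the prime `p ∈ Λ` (finite multiplicity in
the Noetherian domain `Λ`). [folklore] -/
theorem exists_not_C_pow_dvd {a : IwasawaAlgebra p} (ha : a ≠ 0) :
    ∃ N : ℕ, ¬ (PowerSeries.C (p : ℤ_[p]) : IwasawaAlgebra p) ^ N ∣ a := by
  obtain ⟨n, hn⟩ := FiniteMultiplicity.of_prime_left (prime_C p) ha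
  exact ⟨n + 1, hn⟩

/-- **Descent of a relation modulo torsion.** If `a·u + b·v ∈ M_tors` and `p^N ∤ a` or `p^N ∤ b`, then there is a relation
`a′·u + b′·v ∈ M_tors` with `a′ ∉ pΛ` or `b′ ∉ pΛ`: while both coefficients lie in `pΛ` divide by `p`, using that the torsion
submodule is `p`-saturated (`mem_torsion_of_C_smul_mem`); the exponent `N` bounds the number of steps. [folklore] -/
theorem exists_residual_relation_of_not_pow_dvd (u v : M) :
    ∀ (N : ℕ) (a b : IwasawaAlgebra p),
      (¬ (PowerSeries.C (p : ℤ_[p]) : IwasawaAlgebra p) ^ N ∣ a ∨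
        ¬ (PowerSeries.C (p : ℤ_[p]) : IwasawaAlgebra p) ^ N ∣ b) →
      a • u + b • v ∈ Submodule.torsion (IwasawaAlgebra p) M →
      ∃ a' b' : IwasawaAlgebra p, (a' ∉ augIdealP p ∨ b' ∉ augIdealP p) ∧
        a' • u + b' • v ∈ Submodule.torsion (IwasawaAlgebra p) M := by
  intro N
  induction N with
  | zero =>
    intro a b hN _
    simp only [pow_zero, one_dvd, not_true_eq_false, or_self] at hN
  | succ N ih =>
    intro a b hN h
    by_cases hgood : a ∉ augIdealP p ∨ b ∉ augIdealP p
    · exact ⟨a, b, hgood, h⟩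
    · simp only [not_or, not_not] at hgood
      obtain ⟨ha, hb⟩ := hgood
      rw [augIdealP, Ideal.mem_span_singleton] at ha hb
      obtain ⟨a₁, rfl⟩ := ha
      obtain ⟨b₁, rfl⟩ := hb
      refine ih a₁ b₁ ?_ ?_
      · rcases hN with hN | hN
        · exact Or.inl fun hd => hN (by rw [pow_succ']; exact mul_dvd_mul_left _ hd)
        · exact Or.inr fun hd => hN (by rw [pow_succ']; exact mul_dvd_mul_left _ hd)
      · refine mem_torsion_of_C_smul_mem (p := p) ?_
        rw [smul_add, ← mul_smul, ← mul_smul]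
        exact h

/-- **Residual relations on a module of `Λ`-rank `≤ 1` with `μ(X_tors) = 0`.** For `X` finitely generated over `Λ = ℤ_p⟦T⟧` with
`Module.finrank Λ X ≤ 1` and `μ(X_{Λ-tors}) = 0`, any two elements `u, v` satisfy `a·u + b·v = 0` with `a ∉ pΛ` or `b ∉ pΛ`
(i.e. the residual module `X/pX` has `Ω`-rank `≤ 1`): a rank relation, descended modulo torsion
(`exists_residual_relation_of_not_pow_dvd`), then multiplied by an annihilator `g ∉ pΛ` of `X_tors`
(`exists_not_mem_augIdealP_forall_smul_eq_zero`; `pΛ` is prime). [cite: Washington1997, §13.2] -/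
theorem exists_residual_relation [Module.Finite (IwasawaAlgebra p) M]
    (h1 : Module.finrank (IwasawaAlgebra p) M ≤ 1)
    (hμ : muInvariant p (Submodule.torsion (IwasawaAlgebra p) M) = 0) (u v : M) :
    ∃ a b : IwasawaAlgebra p, (a ∉ augIdealP p ∨ b ∉ augIdealP p) ∧ a • u + b • v = 0 := by
  haveI : IsNoetherian (IwasawaAlgebra p) M := isNoetherian_of_isNoetherianRing_of_finite _ _
  set t := Submodule.torsion (IwasawaAlgebra p) M with ht
  haveI : Module.Finite (IwasawaAlgebra p) t := Module.Finite.iff_fg.mpr (IsNoetherian.noetherian t)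
  obtain ⟨g, hg𝔞, hg⟩ := exists_not_mem_augIdealP_forall_smul_eq_zero (M := t)
    (Submodule.torsion_isTorsion) hμ
  -- a non-trivial rank relation
  have hrel : ∃ a b : IwasawaAlgebra p, (a ≠ 0 ∨ b ≠ 0) ∧ a • u + b • v = 0 := by
    by_contra H
    push Not at H
    have hli : LinearIndependent (IwasawaAlgebra p) ![u, v] := by
      rw [LinearIndependent.pair_iff]
      intro s s' hss'
      by_contra hne
      rw [not_and_or] at hne
      exact H s s' hne hss'
    have h2 := hli.fintype_card_le_finrank
    rw [Fintype.card_fin] at h2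
    omega
  obtain ⟨a, b, hab, h0⟩ := hrel
  have hN : ∃ N : ℕ, ¬ (PowerSeries.C (p : ℤ_[p]) : IwasawaAlgebra p) ^ N ∣ a ∨
      ¬ (PowerSeries.C (p : ℤ_[p]) : IwasawaAlgebra p) ^ N ∣ b := by
    rcases hab with ha | hb
    · obtain ⟨N, hN⟩ := exists_not_C_pow_dvd ha
      exact ⟨N, Or.inl hN⟩
    · obtain ⟨N, hN⟩ := exists_not_C_pow_dvd hb
      exact ⟨N, Or.inr hN⟩
  obtain ⟨N, hN⟩ := hN
  obtain ⟨a', b', hab', hmem⟩ := exists_residual_relation_of_not_pow_dvd u v N a b hN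
    (by rw [h0]; exact t.zero_mem)
  have hprime : (augIdealP p).IsPrime := isPrime_augIdealP_holds p
  refine ⟨g * a', g * b', ?_, ?_⟩
  · rcases hab' with ha' | hb'
    · exact Or.inl fun hmul => (hprime.mem_or_mem hmul).elim hg𝔞 ha'
    · exact Or.inr fun hmul => (hprime.mem_or_mem hmul).elim hg𝔞 hb'
  · have hx := congrArg Subtype.val (hg ⟨a' • u + b' • v, hmem⟩)
    rw [Submodule.coe_smul, Submodule.coe_zero] at hx
    rw [mul_smul, mul_smul, ← smul_add]
    exact hx

/-- **Residual relations ⟹ residual growth `#((X/pX) ⧸ T^m) ≤ p^{m + C}`.** For `X` finitely generated over `Λ` in which any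
two elements satisfy a relation with a coefficient outside `pΛ`, the residual module `V = X/pX` — a finitely generated
`Ω = 𝔽_p⟦T⟧`-module through `Λ/p ≅ Ω` — is pairwise dependent, so §1 applies. [cite: Washington1997, §13.2] -/
theorem exists_natCard_residualQuotient_le_of_residual_relation [Module.Finite (IwasawaAlgebra p) M]
    (hdep : ∀ u v : M, ∃ a b : IwasawaAlgebra p, (a ∉ augIdealP p ∨ b ∉ augIdealP p) ∧ a • u + b • v = 0) :
    ∃ C : ℕ, ∀ m : ℕ,
      Nat.card ((M ⧸ (augIdealP p • (⊤ : Submodule (IwasawaAlgebra p) M))) ⧸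
        (Ideal.span {((PowerSeries.X : IwasawaAlgebra p) ^ m)} •
          (⊤ : Submodule (IwasawaAlgebra p) (M ⧸ (augIdealP p • (⊤ : Submodule (IwasawaAlgebra p) M)))))) ≤
      p ^ (m + C) := by
  set 𝔞 : Ideal (IwasawaAlgebra p) := augIdealP p with h𝔞
  set P : Submodule (IwasawaAlgebra p) M := 𝔞 • ⊤ with hP
  let V := M ⧸ P
  -- transport `V` to `Ω = 𝔽_p⟦X⟧`
  let k := IsLocalRing.ResidueField ℤ_[p]
  haveI : Finite k := Finite.of_equiv _ (PadicInt.residueField (p := p)).toEquiv.symm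
  let φ : IwasawaAlgebra p →+* PowerSeries k := PowerSeries.map (IsLocalRing.residue ℤ_[p])
  have hφ : Function.Surjective φ := PowerSeries.map_surjective _ IsLocalRing.residue_surjective
  have hpV : ∀ v : V, (PowerSeries.C (p : ℤ_[p]) : IwasawaAlgebra p) • v = 0 := by
    intro v
    induction v using Submodule.Quotient.induction_on with
    | H x =>
      rw [← Submodule.Quotient.mk_smul, Submodule.Quotient.mk_eq_zero, hP, h𝔞, augIdealP,
        Submodule.ideal_span_singleton_smul, Submodule.mem_smul_pointwise_iff_exists]
      exact ⟨x, Submodule.mem_top, rfl⟩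
  letI instSMul : SMul (PowerSeries k) V := ⟨fun g x => Function.surjInv hφ g • x⟩
  have hsmul_def : ∀ (g : PowerSeries k) (x : V), g • x = Function.surjInv hφ g • x := fun _ _ => rfl
  have hsmul : ∀ (c : IwasawaAlgebra p) (x : V), φ c • x = c • x := by
    intro c x
    rw [hsmul_def]
    have hcc : φ (Function.surjInv hφ (φ c) - c) = 0 := by rw [map_sub, Function.surjInv_eq hφ, sub_self]
    rw [map_residue_eq_zero_iff, augIdealP, Ideal.mem_span_singleton] at hcc
    obtain ⟨q, hq⟩ := hcc
    have : Function.surjInv hφ (φ c) = c + PowerSeries.C (p : ℤ_[p]) * q := by rw [← hq, add_sub_cancel]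
    rw [this, add_smul, mul_comm, mul_smul, hpV, smul_zero, add_zero]
  letI instMod : Module (PowerSeries k) V := Function.Surjective.moduleLeft φ hφ hsmul
  haveI : Module.Finite (PowerSeries k) V := by
    obtain ⟨s, hs⟩ := (inferInstance : Module.Finite (IwasawaAlgebra p) V).fg_top
    refine ⟨⟨s, ?_⟩⟩
    rw [eq_top_iff]
    intro x _
    have hx : x ∈ Submodule.span (IwasawaAlgebra p) (s : Set V) := by rw [hs]; exact Submodule.mem_top
    refine Submodule.span_induction (p := fun y _ => y ∈ Submodule.span (PowerSeries k) (s : Set V))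
      (fun y hy => Submodule.subset_span hy) (Submodule.zero_mem _) (fun _ _ _ _ hy hz => Submodule.add_mem _ hy hz)
      (fun c y _ hy => ?_) hx
    rw [← hsmul]
    exact Submodule.smul_mem _ _ hy
  -- `V` is pairwise dependent over `Ω`
  have hdepV : ∀ x y : V, ∃ a b : PowerSeries k, (a ≠ 0 ∨ b ≠ 0) ∧ a • x + b • y = 0 := by
    intro x y
    induction x using Submodule.Quotient.induction_on with
    | H u =>
      induction y using Submodule.Quotient.induction_on with
      | H v =>
        obtain ⟨a, b, hab, h⟩ := hdep u v
        refine ⟨φ a, φ b, ?_, ?_⟩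
        · rcases hab with ha | hb
          · exact Or.inl fun h0 => ha ((map_residue_eq_zero_iff p a).mp h0)
          · exact Or.inr fun h0 => hb ((map_residue_eq_zero_iff p b).mp h0)
        · rw [hsmul, hsmul, ← Submodule.Quotient.mk_smul, ← Submodule.Quotient.mk_smul,
            ← Submodule.Quotient.mk_add, h, Submodule.Quotient.mk_zero]
  obtain ⟨C, hC⟩ := exists_natCard_quotient_X_pow_le_of_pairwise_dependent (k := k) hdepV
  refine ⟨C, fun m => ?_⟩
  -- translate the `Ω`-quotient into the `Λ`-quotient
  have hXT : φ ((PowerSeries.X : IwasawaAlgebra p) ^ m) = (PowerSeries.X : PowerSeries k) ^ m := by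
    rw [map_pow, PowerSeries.map_X]
  have hcarrier : ∀ y : V,
      y ∈ (Ideal.span {((PowerSeries.X : PowerSeries k) ^ m)} • (⊤ : Submodule (PowerSeries k) V)) ↔
        y ∈ (Ideal.span {((PowerSeries.X : IwasawaAlgebra p) ^ m)} • (⊤ : Submodule (IwasawaAlgebra p) V)) := by
    intro y
    rw [Submodule.ideal_span_singleton_smul, Submodule.ideal_span_singleton_smul,
      Submodule.mem_smul_pointwise_iff_exists, Submodule.mem_smul_pointwise_iff_exists]
    constructor
    · rintro ⟨x, -, rfl⟩
      exact ⟨x, Submodule.mem_top, by rw [← hXT, hsmul]⟩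
    · rintro ⟨x, -, rfl⟩
      exact ⟨x, Submodule.mem_top, by rw [← hXT, hsmul]⟩
  let e : (V ⧸ (Ideal.span {((PowerSeries.X : PowerSeries k) ^ m)} • (⊤ : Submodule (PowerSeries k) V))) ≃
      (V ⧸ (Ideal.span {((PowerSeries.X : IwasawaAlgebra p) ^ m)} • (⊤ : Submodule (IwasawaAlgebra p) V))) :=
    Quotient.congr (Equiv.refl V) fun a b => by
      rw [Submodule.quotientRel_def, Submodule.quotientRel_def, Equiv.refl_apply, Equiv.refl_apply]
      exact hcarrier (a - b)
  have hm := hC m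
  rw [card_residueField_padicInt, Nat.card_congr e] at hm
  exact hm

/-- **Rank `≤ 1` and `μ(X_tors) = 0` ⟹ residual growth `#((X/pX) ⧸ T^m) ≤ p^{m + C}` for all `m`.**
[cite: Washington1997, §13.2] -/
theorem exists_natCard_residualQuotient_le_of_finrank_le_one [Module.Finite (IwasawaAlgebra p) M]
    (h1 : Module.finrank (IwasawaAlgebra p) M ≤ 1)
    (hμ : muInvariant p (Submodule.torsion (IwasawaAlgebra p) M) = 0) :
    ∃ C : ℕ, ∀ m : ℕ,
      Nat.card ((M ⧸ (augIdealP p • (⊤ : Submodule (IwasawaAlgebra p) M))) ⧸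
        (Ideal.span {((PowerSeries.X : IwasawaAlgebra p) ^ m)} •
          (⊤ : Submodule (IwasawaAlgebra p) (M ⧸ (augIdealP p • (⊤ : Submodule (IwasawaAlgebra p) M)))))) ≤
      p ^ (m + C) :=
  exists_natCard_residualQuotient_le_of_residual_relation (exists_residual_relation h1 hμ)


end Lambda

end Summit.BirchSwinnertonDyer.BirchSwinnertonDyer.Theorems.UniversalToricDescentResidualRankLeOneGrowth

end
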